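import Summits.CriticalPhenomena.PercolationContinuityZ3.Theorems.FK.FieldEnergyBounds
import Summits.CriticalPhenomena.PercolationContinuityZ3.Theorems.FK.PositiveFieldPlusFreeAgreement
import Summits.CriticalPhenomena.PercolationContinuityZ3.Theorems.FK.PressureFieldDerivative
import Literature.Probability.LatticeModels.MagnetizationExponentUpperProofs
import HarnessLib

/-!
# THE `β`-DERIVATIVE OF THE PRESSURE IN A FIELD: `∂^±ψ/∂β (β,h) = Σᵢ ⟨σ_0σ_{eᵢ}⟩^{+/∅}_{β,h} + h ⟨σ_0⟩^{+/∅}_{β,h}` (`h ≥ 0`),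
# AND `ψ(·,h) ∈ C¹((0,∞))` WITH `∂ψ/∂β = Σᵢ ⟨σ_0σ_{eᵢ}⟩_{β,h} + h m(β,h)` AT EVERY `h ≠ 0`
# (Friedli–Velenik 2017, Thm. 3.6, Thm. 3.25 (1), Exercises 3.16–3.17; Lebowitz 1977, §3, p. 470)

Claimed R42 (8)(c) in the cell INBOX at 2026-08-29T01:14:38Z by fkp-10a gen 357 (NEW CLAIM #2 of the gen), addressed to coordinator fk-4 gen 288 (seated 01:00Z 2026-08-29 by l.8634; R160 = row FO-10a-g357); lineage row FO-10a-g357f (self-suggested), package g357-field, label HF-D.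
Helper file of the `fk-continuity` build cell (bschramm lane; `--supports stmt-CriticalPhenomena-4575`); builds on
p205010 (kernel theorem, internal audit signed; external expert review pending). No definitions, no named facts, no
sorries; standard axioms. UNCONDITIONAL (nearest-neighbour Ising model on `ℤ^d`; `d ≥ 1` for the `h ≠ 0` statements).

With `E^{bc}(β,h) = Σᵢ ⟨σ_0σ_{eᵢ}⟩^{bc}_{β,h} + h ⟨σ_0⟩^{bc}_{β,h}` and the chords of `FieldEnergyBounds`
(`E⁺(β',h) ≤ slope ψ(·,h) β' β ≤ E^∅(β,h)`, `0 ≤ β' < β`, `h ≥ 0`), the one-sided continuity of the two states in `β`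
(`plusCorr_continuousWithinAt_Ici`, `freeCorr_continuousWithinAt_Iic`) and, at `h > 0`, the agreement of the free and plus
states on all spin products (`freeCorr_eq_plusCorr_of_pos_field`, `PositiveFieldPlusFreeAgreement`):

* **`hasDerivWithinAt_pressure_beta_Ici_field`** — `∂⁺ψ/∂β (β,h) = E⁺(β,h)` for all `β, h ≥ 0`;
  **`hasDerivWithinAt_pressure_beta_Iic_field`** — `∂⁻ψ/∂β (β,h) = E^∅(β,h)` for `β > 0`, `h ≥ 0`;
* **`hasDerivAt_pressure_beta_of_pos_field`** — for `d ≥ 1`, `β > 0`, `h > 0`: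
  `HasDerivAt ψ(·,h) (Σᵢ ⟨σ_0σ_{eᵢ}⟩⁺_{β,h} + h m(β,h)) β` (`m = magnetizationInField = ⟨σ_0⟩⁺`, the tree's
  `magnetizationInField_eq_plusCorr`); `continuousAt_plusCorr_beta_of_pos_field`
  (every `b ↦ ⟨σ_A⟩⁺_{b,h}` is continuous on `(0,∞)` when `h > 0`), `deriv_pressure_beta_of_pos_field`,
  **`continuousOn_deriv_pressure_beta_Ioi_of_pos_field`** — `ψ(·,h) ∈ C¹((0,∞))` for every `h > 0`;
  `hasDerivAt_pressure_beta_of_neg_field` (`h < 0`, by `ψ(β,−h) = ψ(β,h)`);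
* **`differentiableAt_pressure_beta_of_field_ne_zero`** — for `d ≥ 1`, `β > 0` and every `h ≠ 0`, `ψ(·,h)` is differentiable
  at `β`: with `NoLatentHeat` (`β ≤ β_c` at `h = 0`) the only possible kinks of `β ↦ ψ(β,h)` lie on the segment
  `{h = 0, β > β_c(d)}`, where they are the jumps of the energy (`PressureBetaDerivative`).

## References

* S. Friedli, Y. Velenik, *Statistical Mechanics of Lattice Systems*, CUP (2017), Thm. 3.6, Exercise 3.16, Exercise 3.17,
  Thm. 3.25 (1), Lemma 3.31, §3.7.1. [FriedliVelenik2017]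
* J. L. Lebowitz, *Coexistence of phases in Ising ferromagnets*, J. Stat. Phys. 16 (1977) 463–476, §3, p. 470. [Lebowitz1977]
-/

noncomputable section

namespace Summit.CriticalPhenomena.PercolationContinuityZ3.Theorems.FK

namespace IsingEnergyDensity

open MeasureTheory Filter Topology Finset Set
open Literature.Probability.LatticeModels
open Summit.CriticalPhenomena.PercolationContinuityZ3.Theorems.FK.ConcaveLimit
open Summit.CriticalPhenomena.PercolationContinuityZ3.Theorems.FK.IsingSusceptibility

variable {d : ℕ}

/-! ### The one-sided `β`-derivatives at field `h ≥ 0` -/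

/-- **`∂⁺ψ/∂β (β,h) = Σᵢ ⟨σ_0σ_{eᵢ}⟩⁺_{β,h} + h ⟨σ_0⟩⁺_{β,h}`** for all `β, h ≥ 0` (right-continuity of the plus state in
`β`, `plusCorr_continuousWithinAt_Ici`). [cite: Lebowitz1977, §3, proof of Thm. 2, p. 470; FriedliVelenik2017, Exercise 3.17] -/
theorem hasDerivWithinAt_pressure_beta_Ici_field {β h : ℝ} (hβ : 0 ≤ β) (hh : 0 ≤ h) :
    HasDerivWithinAt (fun b => pressure d b h) (∑ i, plusCorr d β h {0, Pi.single i 1} + h * plusCorr d β h {0})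
      (Ici β) β := by
  rw [← hasDerivWithinAt_Ioi_iff_Ici]
  refine hasDerivWithinAt_Ioi_of_slope_squeeze_convex
    (u := fun b => ∑ i, plusCorr d b h {0, Pi.single i 1} + h * plusCorr d b h {0}) ?_ ?_ ?_
  · filter_upwards [self_mem_nhdsWithin] with b hb
    exact (slope_pressure_beta_mem_Icc_field hβ hb hh).1
  · filter_upwards [self_mem_nhdsWithin] with b hb
    exact (slope_pressure_beta_mem_Icc_field hβ hb hh).2.trans
      (freeEnergyField_le_plusEnergyField (hβ.trans (le_of_lt hb)) hh)
  · refine ((tendsto_finsetSum _ fun i _ =>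
        (plusCorr_continuousWithinAt_Ici (d := d) hh {0, Pi.single i 1} hβ).tendsto).add
      ((plusCorr_continuousWithinAt_Ici (d := d) hh {0} hβ).tendsto.const_mul h)).mono_left
      (nhdsWithin_mono _ Ioi_subset_Ici_self)

/-- **`∂⁻ψ/∂β (β,h) = Σᵢ ⟨σ_0σ_{eᵢ}⟩^∅_{β,h} + h ⟨σ_0⟩^∅_{β,h}`** for `β > 0`, `h ≥ 0` (left-continuity of the free state in
`β`, `freeCorr_continuousWithinAt_Iic`). [cite: Lebowitz1977, §3, proof of Thm. 2, p. 470; FriedliVelenik2017, Exercise 3.16] -/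
theorem hasDerivWithinAt_pressure_beta_Iic_field {β h : ℝ} (hβ : 0 < β) (hh : 0 ≤ h) :
    HasDerivWithinAt (fun b => pressure d b h) (∑ i, freeCorr d β h {0, Pi.single i 1} + h * freeCorr d β h {0})
      (Iic β) β := by
  rw [← hasDerivWithinAt_Iio_iff_Iic]
  refine hasDerivWithinAt_Iio_of_slope_squeeze_convex
    (u := fun b => ∑ i, freeCorr d b h {0, Pi.single i 1} + h * freeCorr d b h {0}) ?_ ?_ ?_
  · filter_upwards [Ioo_mem_nhdsLT hβ] with b hb
    exact (freeEnergyField_le_plusEnergyField hb.1.le hh).trans (slope_pressure_beta_mem_Icc_field hb.1.le hb.2 hh).1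
  · filter_upwards [self_mem_nhdsWithin] with b hb
    exact slope_pressure_beta_le_field hβ.le hb hh
  · refine ((tendsto_finsetSum _ fun i _ =>
        (freeCorr_continuousWithinAt_Iic (d := d) hh {0, Pi.single i 1} hβ).tendsto).add
      ((freeCorr_continuousWithinAt_Iic (d := d) hh {0} hβ).tendsto.const_mul h)).mono_left
      (nhdsWithin_mono _ Iio_subset_Iic_self)

/-! ### `h ≠ 0`: the pressure is `C¹` in `β` on `(0, ∞)` -/

/-- **For `d ≥ 1`, `β > 0`, `h > 0`: `HasDerivAt ψ(·,h) (Σᵢ ⟨σ_0σ_{eᵢ}⟩⁺_{β,h} + h m(β,h)) β`** — in a positive field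
the free and plus states coincide (`freeCorr_eq_plusCorr_of_pos_field`), so the two one-sided derivatives agree.
[cite: FriedliVelenik2017, Thm. 3.25 (1) and Thm. 3.6; Lebowitz1977, §3, p. 470] -/
theorem hasDerivAt_pressure_beta_of_pos_field (hd : 1 ≤ d) {β h : ℝ} (hβ : 0 < β) (hh : 0 < h) :
    HasDerivAt (fun b => pressure d b h)
      (∑ i, plusCorr d β h {0, Pi.single i 1} + h * magnetizationInField d β h) β := by
  have h1 := hasDerivWithinAt_pressure_beta_Iic_field (d := d) hβ hh.le
  rw [sum_congr rfl fun i _ => freeCorr_eq_plusCorr_of_pos_field hd hβ.le hh ({0, Pi.single i 1} : Finset (Site d)),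
    freeCorr_eq_plusCorr_of_pos_field hd hβ.le hh] at h1
  have h2 := h1.union (hasDerivWithinAt_pressure_beta_Ici_field (d := d) hβ.le hh.le)
  rw [Iic_union_Ici, hasDerivWithinAt_univ, ← magnetizationInField_eq_plusCorr β h] at h2
  exact h2

/-- **For `d ≥ 1`, `h > 0` and every finite `A`, `b ↦ ⟨σ_A⟩⁺_{b,h}` is continuous at every `β > 0`** (right-continuous,
and equal to the left-continuous `b ↦ ⟨σ_A⟩^∅_{b,h}` on `(0,∞)`). [cite: FriedliVelenik2017, Thm. 3.25 (1), Exercise 3.16–3.17] -/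
theorem continuousAt_plusCorr_beta_of_pos_field (hd : 1 ≤ d) {β h : ℝ} (hβ : 0 < β) (hh : 0 < h)
    (A : Finset (Site d)) : ContinuousAt (fun b => plusCorr d b h A) β := by
  refine continuousAt_iff_continuous_left_right.2 ⟨?_, plusCorr_continuousWithinAt_Ici hh.le A hβ.le⟩
  refine (freeCorr_continuousWithinAt_Iic (d := d) hh.le A hβ).congr_of_eventuallyEq ?_
    (freeCorr_eq_plusCorr_of_pos_field hd hβ.le hh A).symm
  filter_upwards [Ioc_mem_nhdsLE hβ] with b hb
  exact (freeCorr_eq_plusCorr_of_pos_field hd hb.1.le hh A).symm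

/-- `deriv ψ(·,h) β = Σᵢ ⟨σ_0σ_{eᵢ}⟩⁺_{β,h} + h m(β,h)` for `β > 0`, `h > 0` (`d ≥ 1`). [cite: FriedliVelenik2017, Thm. 3.6 and Thm. 3.25 (1)] -/
theorem deriv_pressure_beta_of_pos_field (hd : 1 ≤ d) {β h : ℝ} (hβ : 0 < β) (hh : 0 < h) :
    deriv (fun b => pressure d b h) β = ∑ i, plusCorr d β h {0, Pi.single i 1} + h * magnetizationInField d β h :=
  (hasDerivAt_pressure_beta_of_pos_field hd hβ hh).deriv

/-- **`ψ(·,h) ∈ C¹((0,∞))` for every `h > 0`** (`d ≥ 1`): `deriv ψ(·,h)`, equal to `Σᵢ ⟨σ_0σ_{eᵢ}⟩⁺_{·,h} + h m(·,h)`, is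
continuous on `(0,∞)`. [cite: FriedliVelenik2017, Thm. 3.6, Thm. 3.25 (1), Exercise 3.17] -/
theorem continuousOn_deriv_pressure_beta_Ioi_of_pos_field (hd : 1 ≤ d) {h : ℝ} (hh : 0 < h) :
    ContinuousOn (deriv fun b => pressure d b h) (Ioi 0) := by
  have hc : ContinuousOn (fun b => ∑ i, plusCorr d b h {0, Pi.single i 1} + h * magnetizationInField d b h)
      (Ioi 0) := by
    intro β hβ
    refine ContinuousAt.continuousWithinAt ?_
    simp only [magnetizationInField_eq_plusCorr]
    exact (tendsto_finsetSum _ fun i _ =>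
        (continuousAt_plusCorr_beta_of_pos_field hd hβ hh {0, Pi.single i 1}).tendsto).add
      ((continuousAt_plusCorr_beta_of_pos_field hd hβ hh {0}).tendsto.const_mul h)
  exact hc.congr fun β hβ => deriv_pressure_beta_of_pos_field hd hβ hh

/-- **`h < 0` by symmetry** (`ψ(β,−h) = ψ(β,h)`): for `d ≥ 1`, `β > 0`, `h < 0`,
`HasDerivAt ψ(·,h) (Σᵢ ⟨σ_0σ_{eᵢ}⟩⁺_{β,−h} + (−h) m(β,−h)) β`. [cite: FriedliVelenik2017, §3.7.1 and Thm. 3.6] -/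
theorem hasDerivAt_pressure_beta_of_neg_field (hd : 1 ≤ d) {β h : ℝ} (hβ : 0 < β) (hh : h < 0) :
    HasDerivAt (fun b => pressure d b h)
      (∑ i, plusCorr d β (-h) {0, Pi.single i 1} + (-h) * magnetizationInField d β (-h)) β := by
  have hfun : (fun b => pressure d b h) = fun b => pressure d b (-h) :=
    funext fun b => (pressure_neg_field (d := d) b h).symm
  rw [hfun]
  exact hasDerivAt_pressure_beta_of_pos_field hd hβ (neg_pos.2 hh)

/-- **THE PRESSURE IS DIFFERENTIABLE IN `β` AT EVERY `β > 0` OFF THE LINE `h = 0`** (`d ≥ 1`): for `h ≠ 0`,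
`DifferentiableAt ℝ ψ(·,h) β`. With `NoLatentHeat` (differentiability at `h = 0` for `β ≤ β_c`) the only possible kinks of
`β ↦ ψ(β,h)` lie on `{h = 0, β > β_c(d)}`. [cite: FriedliVelenik2017, Thm. 3.25 (1) and Thm. 3.6; Lebowitz1977, §3, Thm. 2] -/
theorem differentiableAt_pressure_beta_of_field_ne_zero (hd : 1 ≤ d) {β h : ℝ} (hβ : 0 < β) (hh : h ≠ 0) :
    DifferentiableAt ℝ (fun b => pressure d b h) β := by
  rcases hh.lt_or_gt with hneg | hpos
  · exact (hasDerivAt_pressure_beta_of_neg_field hd hβ hneg).differentiableAt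
  · exact (hasDerivAt_pressure_beta_of_pos_field hd hβ hpos).differentiableAt

end IsingEnergyDensity

end Summit.CriticalPhenomena.PercolationContinuityZ3.Theorems.FK

end
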